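import Literature.Topology.FourManifolds.CappellShanesonTwentysevenIntegers
import Literature.Topology.FourManifolds.CappellShanesonIdealClasses
import HarnessLib

/-!
# Kim–Yamada's Theorem 4.17: the seven ideal classes of the non-maximal order `ℤ[Θ₂₇]`

Serves the named fact
`Literature.Topology.FourManifolds.kimYamada2023_nonempty_diffeomorph_sphere_four_of_trace_mem_Icc`
(`CappellShaneson.lean`; M. H. Kim, S. Yamada, *Ideal classes and Cappell–Shaneson homotopy
4-spheres*, Kyungpook Math. J. 63 (2023) 373–411 = arXiv:1707.03860) at the ONE trace of
Kim–Yamada's window `3 ≤ n ≤ 69` where the order `ℤ[Θₙ] = ℤ[x]/(fₙ)`, `fₙ = x³ - nx² + (n-1)x - 1`,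
is NOT the maximal order: `n = 27` (§4.2, Prop. 4.11: "`ℤ[Θ_{49k+27}]` is not integrally closed";
§4.3: "Among `3 ≤ n ≤ 75`, `n = 27` is the only case that `C(ℤ[Θₙ])` is not a group, but a monoid").
The per-trace files `CappellShanesonClassGroup<N>.lean` of the tree run Kim–Yamada's Theorem B
through the class group of the maximal order under Dedekind's hypothesis `𝓞 K = ℤ[θ]`, which fails
here; this file supplies the replacement, Kim–Yamada's

* **Theorem 4.17**: "The ideal class monoid `C(ℤ[Θ₂₇])` consists of the following `7` elements,
  `I₀ = [⟨Θ₂₇-2,7⟩]`, `I₁ = [⟨Θ₂₇-7,17⟩]`, `I₂ = [⟨Θ₂₇-4,5⟩]`, `I₃ = [⟨Θ₂₇-11,13⟩]`,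
  `I₄ = [⟨Θ₂₇-10,11⟩]`, `I₅ = [⟨Θ₂₇-14,19⟩]`, `I₆ = [⟨Θ₂₇-1,1⟩]`",

in the covering form consumed by `exists_isConj_standardCSMatrix_of_cover` /
`gompfConjectureForTrace_of_cover` (`CappellShanesonIdealClasses.lean`): **every non-zero ideal `J`
of `ℤ[Θ₂₇]` satisfies `x J = y ⟨Θ₂₇ - c, d⟩` for some non-zero `x, y ∈ ℤ[Θ₂₇]` and one of the seven
pairs `(c, d)` above** (`ideal_class_adjoinRoot_twentyseven`).  (That the seven classes are
pairwise distinct — the other half of Thm. 4.17 — is not needed for Theorem B and is not proved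
here.)

## The printed proof and the proof given here

Kim–Yamada prove Thm. 4.17 from Prop. 4.12 (every non-invertible ideal is equivalent to
`⟨Θ₂₇ - 2, 7⟩ · J` with `J` invertible, via Lemma 4.13 and Props. 4.14–4.16) and a MAGMA computation
of `Pic(ℤ[Θ₂₇]) ≅ ℤ/6` together with three observed identities between products of ideals (§4.4,
§5.3).  The computer-algebra step is replaced here by the classical conductor-square description
of the ideals of an order, made completely explicit for this order, on top of the class number
one of the maximal order proved in `CappellShanesonTwentysevenIntegers.lean`:

1. `𝓞 K = ℤ[ω]`, `ω = (θ² - 25θ - 3)/7`, `ω³ = -ω² + 12ω + 7`, `θ = ω² + 4ω + 2`, and `𝓞 K` is a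
   PID (`exists_eq_span_singleton_twentyseven`); write `φ : ℤ[Θ₂₇] → 𝓞 K` for the embedding.
2. **Conductor.** `θ - 2 = ω(ω + 4)` and `7 = ω(ω - 3)(ω + 4)` with `ω`, `ω - 3`, `ω + 4` prime
   (`prime_omegaInt_add_twentyseven`), and `(θ - 2) · 𝓞 K ⊆ φ(ℤ[Θ₂₇])`:
   `(θ - 2)(a + bω + cω²) = φ(a(Θ - 2) + b(3Θ + 1) + c(Θ² - 16Θ))`.  Hence for a non-zero ideal
   `J`, with `φ(J) 𝓞 K = α 𝓞 K`, the lattice `N = α⁻¹ φ(J) ⊆ 𝓞 K` contains `(θ - 2) 𝓞 K`, is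
   stable under `φ(ℤ[Θ₂₇])`, and is therefore determined by its image `V` in
   `𝓞 K/(θ - 2) = 𝓞 K/(ω) × 𝓞 K/(ω + 4) ≅ 𝔽₇ × 𝔽₇` (two ring maps `ψ₀ : ω ↦ 0`, `ψ₃ : ω ↦ 3`,
   `MonicCubic.exists_ringHom_of_root`; their common kernel is `(θ - 2)`), an additive subgroup
   stable under the diagonal `𝔽₇ = ψ(ℤ[Θ₂₇])`.
3. The subgroups of `𝔽₇²` are `0`, `𝔽₇²`, the line `{x = 0}` and the seven lines `{y = σx}`
   (`addSubgroup_zmod_seven_sq_cases`): ten lattices `N_V`, each with explicit generators.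
4. For each of the ten lattices an explicit certificate `X · 7N_V = Y · φ(⟨Θ₂₇ - c, d⟩) 𝓞`-free,
   i.e. identities in `ℤ[ω]` expressing `7X` times each generator of `N_V` as `Y` times an element
   of `⟨Θ - c, d⟩` and `Y(Θ - c)`, `Yd` as `7X` times elements of `N_V`, verified by
   `linear_combination` modulo `ω³ = -ω² + 12ω + 7`; then `49x · J = 7α' y · ⟨Θ₂₇ - c, d⟩` inside
   `ℤ[Θ₂₇]` by injectivity of `φ` (`span_mul_eq_of_certificate`).  The ten lattices realise exactly
   Kim–Yamada's seven classes: `V = 0`, `V = 𝔽₇²`, `{x = 0}` and `{y = 0}` all give `[⟨Θ - 2, 7⟩]`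
   (the classes of `(θ - 2)𝓞 K`, `𝓞 K`, `(ω)` and `(ω + 4)`: the non-invertible class `I₀`), the
   diagonal `{y = x}` gives `N = φ(ℤ[Θ₂₇])`, the principal class `[⟨Θ - 1, 1⟩]`, and the five other
   lines give `[⟨Θ-10,11⟩]`, `[⟨Θ-7,17⟩]`, `[⟨Θ-11,13⟩]`, `[⟨Θ-4,5⟩]`, `[⟨Θ-14,19⟩]`
   (`σ = 4, 3, 6, 2, 5`).

(The certificates were found by exact lattice arithmetic in `ℤ[ω]`; only their verification is
part of the proof.)  All statements are theorems; no named facts are introduced.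

## References
* [KimYamada2023] M. H. Kim, S. Yamada, Kyungpook Math. J. 63 (2023), §4.2 Prop. 4.11, §4.3
  Prop. 4.12–4.16 and Thm. 4.17, §4.4, §5.3.
* [Marcus2018] D. A. Marcus, *Number Fields*, 2nd ed., Ch. 2 (orders, conductor), Ch. 3.
-/

noncomputable section

open Polynomial Module NumberField Ideal
open scoped NumberField

namespace Literature.Topology.FourManifolds

open Literature.NumberTheory.NumberFields

/-! ### The additive subgroups of `𝔽₇ × 𝔽₇` -/

/-- The additive subgroups of `ZMod 7 × ZMod 7`: zero, everything, a line `y = σ x`, or the line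
`x = 0`. [folklore] -/
private theorem addSubgroup_zmod_seven_sq_cases (V : AddSubgroup (ZMod 7 × ZMod 7)) :
    (∀ v, v ∈ V ↔ v = 0) ∨ (∀ v, v ∈ V) ∨
      (∃ σ : ZMod 7, ∀ v, v ∈ V ↔ v.2 = σ * v.1) ∨ (∀ v, v ∈ V ↔ v.1 = 0) := by
  have hsmul : ∀ (k : ZMod 7) (v : ZMod 7 × ZMod 7), v ∈ V → (k * v.1, k * v.2) ∈ V := by
    intro k v hv
    have h := V.nsmul_mem hv k.val
    have e : k.val • v = (k * v.1, k * v.2) :=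
      Prod.ext (by rw [Prod.smul_fst, nsmul_eq_mul, ZMod.natCast_zmod_val])
        (by rw [Prod.smul_snd, nsmul_eq_mul, ZMod.natCast_zmod_val])
    rwa [e] at h
  have hinv : ∀ a : ZMod 7, a ≠ 0 → ∃ k : ZMod 7, k * a = 1 := by decide
  by_cases h1 : ∃ v ∈ V, v.1 ≠ 0
  · obtain ⟨v, hv, hv1⟩ := h1
    obtain ⟨k, hk⟩ := hinv v.1 hv1
    set σ := k * v.2 with hσ
    have hgen : ((1 : ZMod 7), σ) ∈ V := by
      have := hsmul k v hv
      rwa [hk] at this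
    have hline : ∀ a : ZMod 7, (a, σ * a) ∈ V := fun a => by
      have := hsmul a _ hgen
      rwa [mul_one, mul_comm] at this
    by_cases h2 : ∃ u ∈ V, u.2 ≠ σ * u.1
    · right; left
      obtain ⟨u, hu, hu2⟩ := h2
      have h0e : ((0 : ZMod 7), u.2 - σ * u.1) ∈ V := by
        have := V.sub_mem hu (hline u.1)
        rwa [Prod.mk_sub_mk, sub_self] at this
      obtain ⟨k', hk'⟩ := hinv _ (sub_ne_zero.mpr hu2)
      have h01 : ((0 : ZMod 7), (1 : ZMod 7)) ∈ V := by
        have := hsmul k' _ h0e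
        rwa [mul_zero, hk'] at this
      intro x
      have hx2 := hsmul (x.2 - σ * x.1) _ h01
      rw [mul_zero, mul_one] at hx2
      have := V.add_mem (hline x.1) hx2
      rwa [Prod.mk_add_mk, add_zero, add_sub_cancel] at this
    · right; right; left
      push Not at h2
      refine ⟨σ, fun x => ⟨h2 x, fun hx => ?_⟩⟩
      have := hline x.1
      rwa [← hx] at this
  · push Not at h1
    by_cases h3 : ∃ v ∈ V, v ≠ 0
    · right; right; right
      obtain ⟨v, hv, hv0⟩ := h3
      have hv2 : v.2 ≠ 0 := fun h => hv0 (Prod.ext (h1 v hv) h)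
      obtain ⟨k, hk⟩ := hinv _ hv2
      have h01 : ((0 : ZMod 7), (1 : ZMod 7)) ∈ V := by
        have := hsmul k v hv
        rwa [h1 v hv, mul_zero, hk] at this
      intro x
      refine ⟨h1 x, fun hx => ?_⟩
      have := hsmul x.2 _ h01
      rw [mul_zero, mul_one, ← hx] at this
      exact this
    · left
      push Not at h3
      intro x
      exact ⟨h3 x, fun hx => hx ▸ V.zero_mem⟩

/-! ### From a lattice certificate to an equation of ideal classes -/

/-- **Certificate ⇒ class equation.**  Let `φ : A → S` be injective, `J ⊆ A` an ideal with
`φ(J) ⊆ α S`, `N = {n : φ j = α n for some j ∈ J}`, and suppose `N` is generated over `φ(A)` and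
`ℤ` by `m₁, m₂, m₃`.  If `7X mᵢ = Y φ(bᵢ)` with `bᵢ ∈ ⟨g₁, g₂⟩` and `Y φ(gᵢ) = 7X nᵢ` with `nᵢ ∈ N`,
then `49x · J = a y · ⟨g₁, g₂⟩` in `A`, where `φ x = X`, `φ y = Y`, `φ a = 7α`. [folklore] -/
private theorem span_mul_eq_of_certificate {A S : Type*} [CommRing A] [CommRing S]
    (φ : A →+* S) (hφ : Function.Injective φ) {J : Ideal A} {N : AddSubgroup S}
    {α X Y m₁ m₂ m₃ n₁ n₂ : S} {a x y g₁ g₂ b₁ b₂ b₃ : A}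
    (hN : ∀ n, n ∈ N ↔ ∃ j ∈ J, φ j = α * n) (hJ : ∀ j ∈ J, ∃ n, φ j = α * n)
    (ha : φ a = 7 * α) (hx : φ x = X) (hy : φ y = Y)
    (hdec : ∀ n ∈ N, ∃ (r : A) (k₂ k₃ : ℤ), n = φ r * m₁ + k₂ * m₂ + k₃ * m₃)
    (hb₁ : b₁ ∈ Ideal.span {g₁, g₂}) (hb₂ : b₂ ∈ Ideal.span {g₁, g₂})
    (hb₃ : b₃ ∈ Ideal.span {g₁, g₂})
    (e₁ : X * (7 * m₁) = Y * φ b₁) (e₂ : X * (7 * m₂) = Y * φ b₂) (e₃ : X * (7 * m₃) = Y * φ b₃)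
    (hn₁ : n₁ ∈ N) (hn₂ : n₂ ∈ N)
    (f₁ : Y * φ g₁ = X * (7 * n₁)) (f₂ : Y * φ g₂ = X * (7 * n₂)) :
    Ideal.span {49 * x} * J = Ideal.span {a * y} * Ideal.span {g₁, g₂} := by
  have hNmul : ∀ (u : A) (n : S), n ∈ N → φ u * n ∈ N := fun u n hn => by
    obtain ⟨j, hj, e⟩ := (hN n).mp hn
    exact (hN _).mpr ⟨u * j, J.mul_mem_left u hj, by rw [map_mul, e]; ring⟩
  apply le_antisymm
  · rw [Ideal.mul_le]
    intro z hz j hj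
    obtain ⟨z, rfl⟩ := Ideal.mem_span_singleton'.mp hz
    obtain ⟨n, hn⟩ := hJ j hj
    obtain ⟨r, k₂, k₃, hdn⟩ := hdec n ((hN n).mpr ⟨j, hj, hn⟩)
    have hmem : z * (a * y) * (r * b₁ + k₂ * b₂ + k₃ * b₃) ∈
        Ideal.span {a * y} * Ideal.span {g₁, g₂} :=
      Ideal.mul_mem_mul (Ideal.mem_span_singleton'.mpr ⟨z, rfl⟩)
        (add_mem (add_mem (Ideal.mul_mem_left _ _ hb₁) (Ideal.mul_mem_left _ _ hb₂))
          (Ideal.mul_mem_left _ _ hb₃))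
    convert hmem using 1
    apply hφ
    simp only [map_mul, map_add, map_intCast, map_ofNat, ha, hx, hy, hn, hdn]
    linear_combination (7 * α * φ z * φ r) * e₁ + (7 * α * φ z * k₂) * e₂ +
      (7 * α * φ z * k₃) * e₃
  · rw [Ideal.mul_le]
    intro z hz i hi
    obtain ⟨z, rfl⟩ := Ideal.mem_span_singleton'.mp hz
    obtain ⟨u, v, rfl⟩ := Ideal.mem_span_pair.mp hi
    have hn : φ u * n₁ + φ v * n₂ ∈ N := N.add_mem (hNmul u _ hn₁) (hNmul v _ hn₂)
    obtain ⟨j, hj, hjn⟩ := (hN _).mp hn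
    have hmem : z * (49 * x) * j ∈ Ideal.span {49 * x} * J :=
      Ideal.mul_mem_mul (Ideal.mem_span_singleton'.mpr ⟨z, rfl⟩) hj
    convert hmem using 1
    apply hφ
    simp only [map_mul, map_add, map_ofNat, ha, hx, hy, hjn]
    linear_combination (7 * α * φ z * φ u) * f₁ + (7 * α * φ z * φ v) * f₂

section Field

variable {K : Type*} [Field K] [NumberField K] {θ : K}

/-! ### `θ` and `θ - 2` in the `ω`-frame; the embedding `ℤ[Θ₂₇] → 𝓞 K` -/

/-- `Θ₂₇ = ω² + 4ω + 2` in `𝓞 K`. [cite: KimYamada2023, §4.2 Prop. 4.11 (proof)] -/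
theorem thetaInt_eq_omega_twentyseven (hθ : aeval θ (csPoly 27) = 0) :
    thetaInt hθ = (MonicCubic.thetaInt (aeval_omega_twentyseven hθ)) ^ 2 +
      4 * MonicCubic.thetaInt (aeval_omega_twentyseven hθ) + 2 := by
  apply RingOfIntegers.ext
  have h := theta_eq_omega_twentyseven hθ
  simp only [thetaInt, MonicCubic.thetaInt, RingOfIntegers.coe_eq_algebraMap, map_add, map_mul,
    map_pow, map_ofNat, RingOfIntegers.map_mk]
  linear_combination h

/-- **The embedding `ℤ[Θₙ] = ℤ[x]/(fₙ) ↪ 𝓞 K`, `Θₙ ↦ θ`** (injective because `fₙ` is the minimal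
polynomial of the algebraic integer `θ`). [cite: KimYamada2023, §2.3] -/
theorem exists_ringHom_adjoinRoot_csPoly {a : ℤ} (hθ : aeval θ (csPoly a) = 0) :
    ∃ φ : AdjoinRoot (csPoly a) →+* 𝓞 K, φ (csRoot a) = thetaInt hθ ∧ Function.Injective φ := by
  have hev : (csPoly a).eval₂ (algebraMap ℤ (𝓞 K)) (thetaInt hθ) = 0 := by
    rw [← aeval_def]; exact aeval_thetaInt hθ
  refine ⟨AdjoinRoot.lift (algebraMap ℤ (𝓞 K)) (thetaInt hθ) hev, AdjoinRoot.lift_root hev, ?_⟩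
  rw [injective_iff_map_eq_zero]
  intro r hr
  obtain ⟨p, rfl⟩ := AdjoinRoot.mk_surjective r
  rw [AdjoinRoot.lift_mk, ← aeval_def] at hr
  have hdvd : minpoly ℤ (thetaInt hθ) ∣ p :=
    minpoly.isIntegrallyClosed_dvd (RingOfIntegers.isIntegral _) hr
  rw [minpoly_thetaInt hθ] at hdvd
  exact AdjoinRoot.mk_eq_zero.mpr hdvd

/-! ### Theorem 4.17 (covering form) for a root of `f₂₇` in a cubic field -/

set_option maxHeartbeats 1600000 in
/-- **Kim–Yamada, Theorem 4.17 (covering form): every non-zero ideal `J` of `ℤ[Θ₂₇]` lies in the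
class of one of `⟨Θ₂₇-1,1⟩`, `⟨Θ₂₇-2,7⟩`, `⟨Θ₂₇-7,17⟩`, `⟨Θ₂₇-4,5⟩`, `⟨Θ₂₇-11,13⟩`, `⟨Θ₂₇-10,11⟩`,
`⟨Θ₂₇-14,19⟩`**, i.e. `x J = y ⟨Θ₂₇ - c, d⟩` with `x, y ≠ 0` — "The ideal class monoid `C(ℤ[Θ₂₇])`
consists of the following `7` elements, `I₀ = [⟨Θ₂₇-2,7⟩]`, `I₁ = [⟨Θ₂₇-7,17⟩]`, `I₂ = [⟨Θ₂₇-4,5⟩]`,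
`I₃ = [⟨Θ₂₇-11,13⟩]`, `I₄ = [⟨Θ₂₇-10,11⟩]`, `I₅ = [⟨Θ₂₇-14,19⟩]`, `I₆ = [⟨Θ₂₇-1,1⟩]`."  Version
over any cubic number field `K = ℚ(θ)`, `f₂₇(θ) = 0` (used through the embedding `ℤ[Θ₂₇] ↪ 𝓞 K`);
proof by the conductor square `𝓞 K/(θ - 2) ≅ 𝔽₇²` and ten explicit lattice certificates (module
docstring). [cite: KimYamada2023, §4.3 Thm. 4.17 (with Prop. 4.12–4.16, §4.4, §5.3)] -/
theorem ideal_class_adjoinRoot_twentyseven_of_root (hθ : aeval θ (csPoly 27) = 0)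
    (h3 : finrank ℚ K = 3) (J : Ideal (AdjoinRoot (csPoly 27))) (hJ : J ≠ ⊥) :
    ∃ x y : AdjoinRoot (csPoly 27), x ≠ 0 ∧ y ≠ 0 ∧
      (span {x} * J = span {y} * csIdeal 1 1 27 ∨ span {x} * J = span {y} * csIdeal 2 7 27 ∨
        span {x} * J = span {y} * csIdeal 7 17 27 ∨ span {x} * J = span {y} * csIdeal 4 5 27 ∨
        span {x} * J = span {y} * csIdeal 11 13 27 ∨ span {x} * J = span {y} * csIdeal 10 11 27 ∨
        span {x} * J = span {y} * csIdeal 14 19 27) := by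
  classical
  -- ### the maximal order `ℤ[ω]`, before abbreviating `ω` as `w`
  have rel := omegaInt_rel_twentyseven hθ
  have hcoords := exists_int_coords_twentyseven hθ h3
  have hp0 := prime_omegaInt_add_twentyseven hθ h3 (k := 0) (Or.inl rfl)
  have hp4 := prime_omegaInt_add_twentyseven hθ h3 (k := 4) (Or.inr (Or.inr rfl))
  -- `𝓞 K/(ω) ≅ 𝔽₇` and `𝓞 K/(ω + 4) ≅ 𝔽₇`: `ψ₀ : ω ↦ 0`, `ψ₃ : ω ↦ 3` (`g(0) ≡ g(3) ≡ 0 mod 7`)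
  obtain ⟨ψ₀, hψ₀⟩ := MonicCubic.exists_ringHom_of_root irreducible_polyQ_twentyseven
    (aeval_omega_twentyseven hθ) h3 disc_twentyseven_sq (0 : ZMod 7) (by decide)
  obtain ⟨ψ₃, hψ₃⟩ := MonicCubic.exists_ringHom_of_root irreducible_polyQ_twentyseven
    (aeval_omega_twentyseven hθ) h3 disc_twentyseven_sq (3 : ZMod 7) (by decide)
  have ht := thetaInt_eq_omega_twentyseven hθ
  obtain ⟨φ, hφr, hφinj⟩ := exists_ringHom_adjoinRoot_csPoly hθ
  set w := MonicCubic.thetaInt (aeval_omega_twentyseven hθ) with hw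
  have hφw : φ (csRoot 27) = w ^ 2 + 4 * w + 2 := hφr.trans ht
  -- evaluation of `φ` on the normal forms used below
  have hφc : ∀ p₀ p₁ p₂ : ℤ, φ (p₀ + p₁ * csRoot 27 + p₂ * csRoot 27 ^ 2) =
      p₀ + p₁ * (w ^ 2 + 4 * w + 2) + p₂ * (w ^ 2 + 4 * w + 2) ^ 2 := fun p₀ p₁ p₂ => by
    simp only [map_add, map_mul, map_pow, map_intCast, hφw]
  have hφb : ∀ p q r c d : ℤ, φ ((p + q * csRoot 27) * (csRoot 27 - c) + r * d) =
      (p + q * (w ^ 2 + 4 * w + 2)) * (w ^ 2 + 4 * w + 2 - c) + r * d := fun p q r c d => by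
    simp only [map_add, map_sub, map_mul, map_intCast, hφw]
  have hφg : ∀ c : ℤ, φ (csRoot 27 - c) = w ^ 2 + 4 * w + 2 - c := fun c => by
    rw [map_sub, map_intCast, hφw]
  have hw0 : w ≠ 0 := by simpa using hp0.ne_zero
  have hw4 : w + 4 ≠ 0 := by
    have := hp4.ne_zero
    rwa [Int.cast_ofNat, add_comm] at this
  have hp4' : Prime (w + 4) := by
    have := hp4
    rwa [Int.cast_ofNat, add_comm] at this
  have hp0' : Prime w := by simpa using hp0
  have h7 : (7 : 𝓞 K) ≠ 0 := by exact_mod_cast (by norm_num : (7 : ℕ) ≠ 0)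
  have h49A : (49 : AdjoinRoot (csPoly 27)) ≠ 0 := by
    have h := intCast_ne_zero_csRoot 27 (show (49 : ℤ) ≠ 0 by norm_num)
    rwa [Int.cast_ofNat] at h
  have h7A : (7 : AdjoinRoot (csPoly 27)) ≠ 0 := by
    have h := intCast_ne_zero_csRoot 27 (show (7 : ℤ) ≠ 0 by norm_num)
    rwa [Int.cast_ofNat] at h
  -- ### `φ(J) 𝓞 K = α 𝓞 K` (class number one) and the lattice `N = α⁻¹ φ(J)`
  obtain ⟨α, hα⟩ := exists_eq_span_singleton_twentyseven hθ h3 (J.map φ)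
  have hα0 : α ≠ 0 := by
    rintro rfl
    have h0 : J.map φ = ⊥ := by rw [hα, Ideal.span_singleton_eq_bot]
    exact hJ ((Ideal.map_eq_bot_iff_of_injective hφinj).mp h0)
  set N : AddSubgroup (𝓞 K) :=
    (J.toAddSubgroup.map φ.toAddMonoidHom).comap (AddMonoidHom.mulLeft α) with hNdef
  have hN : ∀ n, n ∈ N ↔ ∃ j ∈ J, φ j = α * n := fun n => by
    simp only [hNdef, AddSubgroup.mem_comap, AddSubgroup.mem_map, AddMonoidHom.coe_mulLeft,
      Submodule.mem_toAddSubgroup, RingHom.toAddMonoidHom_eq_coe, AddMonoidHom.coe_coe]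
  have hmapJ : ∀ j ∈ J, ∃ n, φ j = α * n := fun j hj => by
    have h : φ j ∈ J.map φ := Ideal.mem_map_of_mem φ hj
    rw [hα, Ideal.mem_span_singleton'] at h
    obtain ⟨n, hn⟩ := h
    exact ⟨n, by rw [← hn, mul_comm]⟩
  -- ### the conductor: `(θ - 2) 𝓞 K = (ω² + 4ω) 𝓞 K ⊆ φ(ℤ[Θ₂₇])`, hence `(θ - 2) 𝓞 K ⊆ N`
  have hL : ∀ o : 𝓞 K, ∃ r : AdjoinRoot (csPoly 27), φ r = (w ^ 2 + 4 * w) * o := fun o => by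
    obtain ⟨a, b, c, rfl⟩ := hcoords o
    -- `(θ - 2)(a + bω + cω²) = a(θ - 2) + b(3θ + 1) + c(θ² - 16θ)`
    refine ⟨(-2 * a + b : ℤ) + (a + 3 * b - 16 * c : ℤ) * csRoot 27 + c * csRoot 27 ^ 2, ?_⟩
    rw [hφc]
    push_cast
    linear_combination (4 * (c : 𝓞 K) - (b : 𝓞 K)) * rel
  have hNL : ∀ o : 𝓞 K, (w ^ 2 + 4 * w) * o ∈ N := by
    have key : ∀ z ∈ J.map φ, ∀ o : 𝓞 K, ∃ j ∈ J, φ j = (w ^ 2 + 4 * w) * o * z := by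
      intro z hz
      have hz' : z ∈ Submodule.span (𝓞 K) (⇑φ '' ↑J) := hz
      refine Submodule.span_induction ?_ ?_ ?_ ?_ hz'
      · rintro _ ⟨j, hj, rfl⟩ o
        obtain ⟨r, hr⟩ := hL o
        exact ⟨r * j, J.mul_mem_left r hj, by rw [map_mul, hr]⟩
      · intro o
        exact ⟨0, J.zero_mem, by simp⟩
      · intro x y _ _ hx hy o
        obtain ⟨j₁, hj₁, e₁⟩ := hx o
        obtain ⟨j₂, hj₂, e₂⟩ := hy o
        exact ⟨j₁ + j₂, J.add_mem hj₁ hj₂, by rw [map_add, e₁, e₂]; ring⟩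
      · intro s x _ hx o
        obtain ⟨j, hj, e⟩ := hx (o * s)
        exact ⟨j, hj, by rw [e, smul_eq_mul]; ring⟩
    intro o
    have hαmem : α ∈ J.map φ := by rw [hα]; exact Ideal.mem_span_singleton_self α
    obtain ⟨j, hj, e⟩ := key α hαmem o
    exact (hN _).mpr ⟨j, hj, by rw [e]; ring⟩
  obtain ⟨a, ha⟩ : ∃ a : AdjoinRoot (csPoly 27), φ a = 7 * α := by
    obtain ⟨r, hr⟩ := hL ((w - 3) * α)
    exact ⟨r, by rw [hr]; linear_combination α * rel⟩
  have ha0 : a ≠ 0 := by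
    rintro rfl
    rw [map_zero] at ha
    exact mul_ne_zero h7 hα0 ha.symm
  -- ### `𝓞 K/(θ - 2) ≅ 𝔽₇ × 𝔽₇`: `ψ₀ : ω ↦ 0`, `ψ₃ : ω ↦ 3`, common kernel `(ω(ω + 4)) = (θ - 2)`
  have hker : ∀ z : 𝓞 K, ψ₀ z = 0 → ψ₃ z = 0 → ∃ o, z = (w ^ 2 + 4 * w) * o := by
    have hmax : (Ideal.span {w}).IsMaximal :=
      ((Ideal.span_singleton_prime hw0).mpr hp0').isMaximal
        (by rw [Ne, Ideal.span_singleton_eq_bot]; exact hw0)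
    have hle : Ideal.span {w} ≤ RingHom.ker ψ₀ := by
      rw [Ideal.span_singleton_le_iff_mem, RingHom.mem_ker, hψ₀]
    have htop : RingHom.ker ψ₀ ≠ ⊤ := fun h => by
      have h1 := (Ideal.eq_top_iff_one _).mp h
      rw [RingHom.mem_ker, map_one] at h1
      revert h1; decide
    have hkerw : RingHom.ker ψ₀ = Ideal.span {w} := (hmax.eq_of_le htop hle).symm
    intro z h0 h3'
    have hz : z ∈ Ideal.span {w} := by rw [← hkerw, RingHom.mem_ker]; exact h0
    obtain ⟨z₁, rfl⟩ := Ideal.mem_span_singleton'.mp hz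
    have h4 : (w + 4) ∣ z₁ * w := by
      have hmax4 : (Ideal.span {w + 4}).IsMaximal :=
        ((Ideal.span_singleton_prime hw4).mpr hp4').isMaximal
          (by rw [Ne, Ideal.span_singleton_eq_bot]; exact hw4)
      have h70 : (3 : ZMod 7) + 4 = 0 := by decide
      have hle4 : Ideal.span {w + 4} ≤ RingHom.ker ψ₃ := by
        rw [Ideal.span_singleton_le_iff_mem, RingHom.mem_ker, map_add, hψ₃, map_ofNat, h70]
      have htop4 : RingHom.ker ψ₃ ≠ ⊤ := fun h => by
        have h1 := (Ideal.eq_top_iff_one _).mp h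
        rw [RingHom.mem_ker, map_one] at h1
        revert h1; decide
      have hker4 : RingHom.ker ψ₃ = Ideal.span {w + 4} := (hmax4.eq_of_le htop4 hle4).symm
      have hz4 : z₁ * w ∈ Ideal.span {w + 4} := by rw [← hker4, RingHom.mem_ker]; exact h3'
      exact Ideal.mem_span_singleton.mp hz4
    rcases hp4'.dvd_or_dvd h4 with h | h
    · obtain ⟨o, rfl⟩ := h
      exact ⟨o, by ring⟩
    · exfalso
      obtain ⟨u, hu⟩ := h
      have h' := congrArg ψ₃ hu
      rw [hψ₃, map_mul, map_add, hψ₃, map_ofNat] at h'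
      have h70 : (3 : ZMod 7) + 4 = 0 := by decide
      rw [h70, zero_mul] at h'
      revert h'; decide
  -- ### the image `V ⊆ 𝔽₇²` of `N` determines `N`
  set V : AddSubgroup (ZMod 7 × ZMod 7) := N.map (ψ₀.prod ψ₃).toAddMonoidHom with hVdef
  have hNV : ∀ n, n ∈ N ↔ (ψ₀ n, ψ₃ n) ∈ V := fun n => by
    rw [hVdef, AddSubgroup.mem_map]
    constructor
    · exact fun hn => ⟨n, hn, rfl⟩
    · rintro ⟨m, hm, hmn⟩
      have e0 : ψ₀ m = ψ₀ n := congrArg Prod.fst hmn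
      have e3 : ψ₃ m = ψ₃ n := congrArg Prod.snd hmn
      obtain ⟨o, ho⟩ := hker (n - m) (by rw [map_sub, e0, sub_self])
        (by rw [map_sub, e3, sub_self])
      have : n = m + (w ^ 2 + 4 * w) * o := by rw [← ho]; ring
      rw [this]
      exact N.add_mem hm (hNL o)
  -- generic decomposition of the kernel part:
  -- `(θ - 2)(a + bω + cω²) = φ(a + c(Θ - 2))·(θ - 2) + (b - 4c)(3θ + 1)`
  have hdec0 : ∀ z : 𝓞 K, ψ₀ z = 0 → ψ₃ z = 0 → ∃ (r : AdjoinRoot (csPoly 27)) (k : ℤ),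
      z = φ r * (4 * w + w ^ 2) + k * (7 + 12 * w + 3 * w ^ 2) := by
    intro z h0 h3'
    obtain ⟨o, rfl⟩ := hker z h0 h3'
    obtain ⟨a₁, b₁, c₁, rfl⟩ := hcoords o
    refine ⟨(a₁ - 2 * c₁ : ℤ) + c₁ * csRoot 27 + (0 : ℤ) * csRoot 27 ^ 2, b₁ - 4 * c₁, ?_⟩
    rw [hφc]
    push_cast
    linear_combination ((b₁ : 𝓞 K) - 4 * (c₁ : 𝓞 K)) * rel
  -- evaluation of `ψ₀`, `ψ₃` on normal forms, and integer multiples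
  have hψ₀c : ∀ p₀ p₁ p₂ : ℤ, ψ₀ (p₀ + p₁ * w + p₂ * w ^ 2) = p₀ := fun p₀ p₁ p₂ => by
    simp only [map_add, map_mul, map_pow, map_intCast, hψ₀]
    ring
  have hψ₃c : ∀ p₀ p₁ p₂ : ℤ, ψ₃ (p₀ + p₁ * w + p₂ * w ^ 2) = p₀ + p₁ * 3 + p₂ * 9 :=
      fun p₀ p₁ p₂ => by
    simp only [map_add, map_mul, map_pow, map_intCast, hψ₃]
    ring
  have hψ₀k : ∀ (v : ZMod 7) (z : 𝓞 K), ψ₀ (((v.val : ℤ) : 𝓞 K) * z) = v * ψ₀ z := fun v z => by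
    rw [map_mul, map_intCast, Int.cast_natCast, ZMod.natCast_zmod_val]
  have hψ₃k : ∀ (v : ZMod 7) (z : 𝓞 K), ψ₃ (((v.val : ℤ) : 𝓞 K) * z) = v * ψ₃ z := fun v z => by
    rw [map_mul, map_intCast, Int.cast_natCast, ZMod.natCast_zmod_val]
  -- ### the ten subgroups `V` and their certificates
  rcases addSubgroup_zmod_seven_sq_cases V with hV | hV | ⟨σ, hV⟩ | hV
  · -- `V`-shape `zero`: the class of `⟨Θ - 2, 7⟩`
    -- (`X = 1`, `Y = 7`)
    have hx : φ 1 = 1 := map_one φ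
    have hX : (1 : 𝓞 K) ≠ 0 := one_ne_zero
    have hdec : ∀ n ∈ N, ∃ (r : AdjoinRoot (csPoly 27)) (k₂ k₃ : ℤ),
        n = φ r * (4 * w + w ^ 2) + k₂ * (7 + 12 * w + 3 * w ^ 2) + k₃ * 0 := by
      intro n hn
      have hv := (hV _).mp ((hNV n).mp hn)
      rw [Prod.mk_eq_zero] at hv
      obtain ⟨r, k₂, e⟩ := hdec0 n hv.1 hv.2
      exact ⟨r, k₂, 0, by rw [e, Int.cast_zero, zero_mul, add_zero]⟩
    have e1 : 1 * (7 * (4 * w + w ^ 2)) =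
        7 * φ (((1 : ℤ) + (0 : ℤ) * csRoot 27) * (csRoot 27 - ((2 : ℤ) : AdjoinRoot (csPoly
            27))) + (0 : ℤ) * ((7 : ℤ) : AdjoinRoot (csPoly 27))) := by
      rw [hφb]
      push_cast
      ring
    have e2 : 1 * (7 * (7 + 12 * w + 3 * w ^ 2)) =
        7 * φ (((3 : ℤ) + (0 : ℤ) * csRoot 27) * (csRoot 27 - ((2 : ℤ) : AdjoinRoot (csPoly
            27))) + (1 : ℤ) * ((7 : ℤ) : AdjoinRoot (csPoly 27))) := by
      rw [hφb]
      push_cast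
      ring
    have e3 : 1 * (7 * 0) =
        7 * φ (((0 : ℤ) + (0 : ℤ) * csRoot 27) * (csRoot 27 - ((2 : ℤ) : AdjoinRoot (csPoly
            27))) + (0 : ℤ) * ((7 : ℤ) : AdjoinRoot (csPoly 27))) := by
      rw [hφb]
      push_cast
      ring
    have hn1 : (((0 : ℤ) + (4 : ℤ) * w + (1 : ℤ) * w ^ 2 : 𝓞 K)) ∈ N :=
      (hNV _).mpr ((hV _).mpr (by rw [hψ₀c, hψ₃c]; decide))
    have f1 : 7 * φ (csRoot 27 - ((2 : ℤ) : AdjoinRoot (csPoly 27))) = 1 * (7 * ((0 : ℤ) + (4 :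
        ℤ) * w + (1 : ℤ) * w ^ 2)) := by
      rw [hφg]
      push_cast
      ring
    have hn2 : (((7 : ℤ) + (0 : ℤ) * w + (0 : ℤ) * w ^ 2 : 𝓞 K)) ∈ N :=
      (hNV _).mpr ((hV _).mpr (by rw [hψ₀c, hψ₃c]; decide))
    have f2 : 7 * φ (((7 : ℤ) : AdjoinRoot (csPoly 27))) = 1 * (7 * ((7 : ℤ) + (0 : ℤ) * w + (0
        : ℤ) * w ^ 2)) := by
      rw [map_intCast]
      push_cast
      ring
    refine ⟨49 * 1, a * 7, mul_ne_zero h49A fun h => hX (by rw [← hx, h, map_zero]),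
      mul_ne_zero ha0 h7A, Or.inr (Or.inl ?_)⟩
    exact span_mul_eq_of_certificate φ hφinj hN hmapJ ha hx (map_ofNat φ 7) hdec
      (Ideal.mem_span_pair.mpr ⟨_, _, rfl⟩) (Ideal.mem_span_pair.mpr ⟨_, _, rfl⟩)
      (Ideal.mem_span_pair.mpr ⟨_, _, rfl⟩) e1 e2 e3 hn1 hn2 f1 f2
  · -- `V`-shape `top`: the class of `⟨Θ - 2, 7⟩`
    -- (`X = 4 * w + w ^ 2`, `Y = 7`)
    have hx : φ ((-2 : ℤ) + (1 : ℤ) * csRoot 27 + (0 : ℤ) * csRoot 27 ^ 2) = (4 * w + w ^ 2) :=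
        by
      rw [hφc]
      push_cast
      ring
    have hX : (4 * w + w ^ 2) ≠ 0 := by
      have e : (4 * w + w ^ 2) = w * (w + 4) := by ring
      rw [e]
      exact mul_ne_zero hw0 hw4
    have hdec : ∀ n ∈ N, ∃ (r : AdjoinRoot (csPoly 27)) (k₂ k₃ : ℤ),
        n = φ r * 1 + k₂ * w + k₃ * 0 := by
      intro n hn
      obtain ⟨a₁, b₁, c₁, e⟩ := hcoords n
      refine ⟨(a₁ - 2 * c₁ : ℤ) + c₁ * csRoot 27 + (0 : ℤ) * csRoot 27 ^ 2, b₁ - 4 * c₁, 0, ?_⟩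
      rw [e, hφc]
      push_cast
      ring
    have e1 : (4 * w + w ^ 2) * (7 * 1) =
        7 * φ (((1 : ℤ) + (0 : ℤ) * csRoot 27) * (csRoot 27 - ((2 : ℤ) : AdjoinRoot (csPoly
            27))) + (0 : ℤ) * ((7 : ℤ) : AdjoinRoot (csPoly 27))) := by
      rw [hφb]
      push_cast
      ring
    have e2 : (4 * w + w ^ 2) * (7 * w) =
        7 * φ (((3 : ℤ) + (0 : ℤ) * csRoot 27) * (csRoot 27 - ((2 : ℤ) : AdjoinRoot (csPoly
            27))) + (1 : ℤ) * ((7 : ℤ) : AdjoinRoot (csPoly 27))) := by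
      rw [hφb]
      push_cast
      linear_combination (7) * rel
    have e3 : (4 * w + w ^ 2) * (7 * 0) =
        7 * φ (((0 : ℤ) + (0 : ℤ) * csRoot 27) * (csRoot 27 - ((2 : ℤ) : AdjoinRoot (csPoly
            27))) + (0 : ℤ) * ((7 : ℤ) : AdjoinRoot (csPoly 27))) := by
      rw [hφb]
      push_cast
      ring
    have hn1 : (((1 : ℤ) + (0 : ℤ) * w + (0 : ℤ) * w ^ 2 : 𝓞 K)) ∈ N := (hNV _).mpr (hV _)
    have f1 : 7 * φ (csRoot 27 - ((2 : ℤ) : AdjoinRoot (csPoly 27))) = (4 * w + w ^ 2) * (7 *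
        ((1 : ℤ) + (0 : ℤ) * w + (0 : ℤ) * w ^ 2)) := by
      rw [hφg]
      push_cast
      ring
    have hn2 : (((-3 : ℤ) + (1 : ℤ) * w + (0 : ℤ) * w ^ 2 : 𝓞 K)) ∈ N := (hNV _).mpr (hV _)
    have f2 : 7 * φ (((7 : ℤ) : AdjoinRoot (csPoly 27))) = (4 * w + w ^ 2) * (7 * ((-3 : ℤ) +
        (1 : ℤ) * w + (0 : ℤ) * w ^ 2)) := by
      rw [map_intCast]
      push_cast
      linear_combination (-7) * rel
    refine ⟨49 * ((-2 : ℤ) + (1 : ℤ) * csRoot 27 + (0 : ℤ) * csRoot 27 ^ 2), a * 7, mul_ne_zero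
        h49A fun h => hX (by rw [← hx, h, map_zero]),
      mul_ne_zero ha0 h7A, Or.inr (Or.inl ?_)⟩
    exact span_mul_eq_of_certificate φ hφinj hN hmapJ ha hx (map_ofNat φ 7) hdec
      (Ideal.mem_span_pair.mpr ⟨_, _, rfl⟩) (Ideal.mem_span_pair.mpr ⟨_, _, rfl⟩)
      (Ideal.mem_span_pair.mpr ⟨_, _, rfl⟩) e1 e2 e3 hn1 hn2 f1 f2
  · have h7cases : ∀ τ : ZMod 7, τ = 0 ∨ τ = 1 ∨ τ = 2 ∨ τ = 3 ∨ τ = 4 ∨ τ = 5 ∨ τ = 6 := by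
      decide
    rcases h7cases σ with rfl | rfl | rfl | rfl | rfl | rfl | rfl
    · -- `V`-shape `line`, σ = 0: the class of `⟨Θ - 2, 7⟩`
      -- (`X = 7 * w`, `Y = 49`)
      have hx : φ ((-3 : ℤ) + (-25 : ℤ) * csRoot 27 + (1 : ℤ) * csRoot 27 ^ 2) = (7 * w) := by
        rw [hφc]
        push_cast
        linear_combination (7 + w) * rel
      have hX : (7 * w) ≠ 0 := by
        have hγ : (((0 : ℤ) + (1 : ℤ) * w + (0 : ℤ) * w ^ 2 : 𝓞 K)) ≠ 0 := fun h => by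
          have h' := congrArg ψ₃ h
          rw [hψ₃c, map_zero] at h'
          revert h'
          decide
        have e : (7 * w) = 7 * (((0 : ℤ) + (1 : ℤ) * w + (0 : ℤ) * w ^ 2 : 𝓞 K)) := by
          push_cast
          ring
        rw [e]
        exact mul_ne_zero h7 hγ
      have hdec : ∀ n ∈ N, ∃ (r : AdjoinRoot (csPoly 27)) (k₂ k₃ : ℤ),
          n = φ r * (4 * w + w ^ 2) + k₂ * (7 + 12 * w + 3 * w ^ 2) + k₃ * ((1 : ℤ) + (2 : ℤ) * w
              + (0 : ℤ) * w ^ 2) := by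
        intro n hn
        have hv := (hV _).mp ((hNV n).mp hn)
        dsimp only at hv
        obtain ⟨r, k₂, e⟩ := hdec0 (n - ((ψ₀ n).val : ℤ) * ((1 : ℤ) + (2 : ℤ) * w + (0 : ℤ) * w ^
            2))
          (by rw [map_sub, hψ₀k, hψ₀c, Int.cast_one, mul_one, sub_self])
          (by
            rw [map_sub, hψ₃k, hψ₃c, hv]
            generalize ψ₀ n = u
            revert u
            decide)
        exact ⟨r, k₂, ((ψ₀ n).val : ℤ), sub_eq_iff_eq_add.mp e⟩
      have e1 : (7 * w) * (7 * (4 * w + w ^ 2)) =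
          49 * φ (((3 : ℤ) + (0 : ℤ) * csRoot 27) * (csRoot 27 - ((2 : ℤ) : AdjoinRoot (csPoly
              27))) + (1 : ℤ) * ((7 : ℤ) : AdjoinRoot (csPoly 27))) := by
        rw [hφb]
        push_cast
        linear_combination (49) * rel
      have e2 : (7 * w) * (7 * (7 + 12 * w + 3 * w ^ 2)) =
          49 * φ (((-14 : ℤ) + (1 : ℤ) * csRoot 27) * (csRoot 27 - ((2 : ℤ) : AdjoinRoot (csPoly
              27))) + (-4 : ℤ) * ((7 : ℤ) : AdjoinRoot (csPoly 27))) := by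
        rw [hφb]
        push_cast
        linear_combination (-196 - 49 * w) * rel
      have e3 : (7 * w) * (7 * ((1 : ℤ) + (2 : ℤ) * w + (0 : ℤ) * w ^ 2)) =
          49 * φ (((25 : ℤ) + (-1 : ℤ) * csRoot 27) * (csRoot 27 - ((2 : ℤ) : AdjoinRoot (csPoly
              27))) + (7 : ℤ) * ((7 : ℤ) : AdjoinRoot (csPoly 27))) := by
        rw [hφb]
        push_cast
        linear_combination (343 + 49 * w) * rel
      have hn1 : (((4 : ℤ) + (1 : ℤ) * w + (0 : ℤ) * w ^ 2 : 𝓞 K)) ∈ N :=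
        (hNV _).mpr ((hV _).mpr (by rw [hψ₀c, hψ₃c]; decide))
      have f1 : 49 * φ (csRoot 27 - ((2 : ℤ) : AdjoinRoot (csPoly 27))) = (7 * w) * (7 * ((4 : ℤ)
          + (1 : ℤ) * w + (0 : ℤ) * w ^ 2)) := by
        rw [hφg]
        push_cast
        ring
      have hn2 : (((-12 : ℤ) + (1 : ℤ) * w + (1 : ℤ) * w ^ 2 : 𝓞 K)) ∈ N :=
        (hNV _).mpr ((hV _).mpr (by rw [hψ₀c, hψ₃c]; decide))
      have f2 : 49 * φ (((7 : ℤ) : AdjoinRoot (csPoly 27))) = (7 * w) * (7 * ((-12 : ℤ) + (1 : ℤ)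
          * w + (1 : ℤ) * w ^ 2)) := by
        rw [map_intCast]
        push_cast
        linear_combination (-49) * rel
      refine ⟨49 * ((-3 : ℤ) + (-25 : ℤ) * csRoot 27 + (1 : ℤ) * csRoot 27 ^ 2), a * 49,
          mul_ne_zero h49A fun h => hX (by rw [← hx, h, map_zero]),
        mul_ne_zero ha0 h49A, Or.inr (Or.inl ?_)⟩
      exact span_mul_eq_of_certificate φ hφinj hN hmapJ ha hx (map_ofNat φ 49) hdec
        (Ideal.mem_span_pair.mpr ⟨_, _, rfl⟩) (Ideal.mem_span_pair.mpr ⟨_, _, rfl⟩)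
        (Ideal.mem_span_pair.mpr ⟨_, _, rfl⟩) e1 e2 e3 hn1 hn2 f1 f2
    · -- `V`-shape `line`, σ = 1: the class of `⟨Θ - 1, 1⟩`
      -- (`X = 1`, `Y = 7`)
      have hx : φ 1 = 1 := map_one φ
      have hX : (1 : 𝓞 K) ≠ 0 := one_ne_zero
      have hdec : ∀ n ∈ N, ∃ (r : AdjoinRoot (csPoly 27)) (k₂ k₃ : ℤ),
          n = φ r * (4 * w + w ^ 2) + k₂ * (7 + 12 * w + 3 * w ^ 2) + k₃ * ((1 : ℤ) + (0 : ℤ) * w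
              + (0 : ℤ) * w ^ 2) := by
        intro n hn
        have hv := (hV _).mp ((hNV n).mp hn)
        dsimp only at hv
        obtain ⟨r, k₂, e⟩ := hdec0 (n - ((ψ₀ n).val : ℤ) * ((1 : ℤ) + (0 : ℤ) * w + (0 : ℤ) * w ^
            2))
          (by rw [map_sub, hψ₀k, hψ₀c, Int.cast_one, mul_one, sub_self])
          (by
            rw [map_sub, hψ₃k, hψ₃c, hv]
            generalize ψ₀ n = u
            revert u
            decide)
        exact ⟨r, k₂, ((ψ₀ n).val : ℤ), sub_eq_iff_eq_add.mp e⟩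
      have e1 : 1 * (7 * (4 * w + w ^ 2)) =
          7 * φ (((1 : ℤ) + (0 : ℤ) * csRoot 27) * (csRoot 27 - ((1 : ℤ) : AdjoinRoot (csPoly
              27))) + (-1 : ℤ) * ((1 : ℤ) : AdjoinRoot (csPoly 27))) := by
        rw [hφb]
        push_cast
        ring
      have e2 : 1 * (7 * (7 + 12 * w + 3 * w ^ 2)) =
          7 * φ (((3 : ℤ) + (0 : ℤ) * csRoot 27) * (csRoot 27 - ((1 : ℤ) : AdjoinRoot (csPoly
              27))) + (4 : ℤ) * ((1 : ℤ) : AdjoinRoot (csPoly 27))) := by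
        rw [hφb]
        push_cast
        ring
      have e3 : 1 * (7 * ((1 : ℤ) + (0 : ℤ) * w + (0 : ℤ) * w ^ 2)) =
          7 * φ (((0 : ℤ) + (0 : ℤ) * csRoot 27) * (csRoot 27 - ((1 : ℤ) : AdjoinRoot (csPoly
              27))) + (1 : ℤ) * ((1 : ℤ) : AdjoinRoot (csPoly 27))) := by
        rw [hφb]
        push_cast
        ring
      have hn1 : (((1 : ℤ) + (4 : ℤ) * w + (1 : ℤ) * w ^ 2 : 𝓞 K)) ∈ N :=
        (hNV _).mpr ((hV _).mpr (by rw [hψ₀c, hψ₃c]; decide))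
      have f1 : 7 * φ (csRoot 27 - ((1 : ℤ) : AdjoinRoot (csPoly 27))) = 1 * (7 * ((1 : ℤ) + (4 :
          ℤ) * w + (1 : ℤ) * w ^ 2)) := by
        rw [hφg]
        push_cast
        ring
      have hn2 : (((1 : ℤ) + (0 : ℤ) * w + (0 : ℤ) * w ^ 2 : 𝓞 K)) ∈ N :=
        (hNV _).mpr ((hV _).mpr (by rw [hψ₀c, hψ₃c]; decide))
      have f2 : 7 * φ (((1 : ℤ) : AdjoinRoot (csPoly 27))) = 1 * (7 * ((1 : ℤ) + (0 : ℤ) * w + (0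
          : ℤ) * w ^ 2)) := by
        rw [map_intCast]
        push_cast
        ring
      refine ⟨49 * 1, a * 7, mul_ne_zero h49A fun h => hX (by rw [← hx, h, map_zero]),
        mul_ne_zero ha0 h7A, Or.inl ?_⟩
      exact span_mul_eq_of_certificate φ hφinj hN hmapJ ha hx (map_ofNat φ 7) hdec
        (Ideal.mem_span_pair.mpr ⟨_, _, rfl⟩) (Ideal.mem_span_pair.mpr ⟨_, _, rfl⟩)
        (Ideal.mem_span_pair.mpr ⟨_, _, rfl⟩) e1 e2 e3 hn1 hn2 f1 f2
    · -- `V`-shape `line`, σ = 2: the class of `⟨Θ - 4, 5⟩`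
      -- (`X = -7 - 7 * w`, `Y = 49`)
      have hx : φ ((-4 : ℤ) + (25 : ℤ) * csRoot 27 + (-1 : ℤ) * csRoot 27 ^ 2) = (-7 - 7 * w) :=
          by
        rw [hφc]
        push_cast
        linear_combination (-7 - w) * rel
      have hX : (-7 - 7 * w) ≠ 0 := by
        have hγ : (((-1 : ℤ) + (-1 : ℤ) * w + (0 : ℤ) * w ^ 2 : 𝓞 K)) ≠ 0 := fun h => by
          have h' := congrArg ψ₀ h
          rw [hψ₀c, map_zero] at h'
          revert h'
          decide
        have e : (-7 - 7 * w) = 7 * (((-1 : ℤ) + (-1 : ℤ) * w + (0 : ℤ) * w ^ 2 : 𝓞 K)) := by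
          push_cast
          ring
        rw [e]
        exact mul_ne_zero h7 hγ
      have hdec : ∀ n ∈ N, ∃ (r : AdjoinRoot (csPoly 27)) (k₂ k₃ : ℤ),
          n = φ r * (4 * w + w ^ 2) + k₂ * (7 + 12 * w + 3 * w ^ 2) + k₃ * ((1 : ℤ) + (5 : ℤ) * w
              + (0 : ℤ) * w ^ 2) := by
        intro n hn
        have hv := (hV _).mp ((hNV n).mp hn)
        dsimp only at hv
        obtain ⟨r, k₂, e⟩ := hdec0 (n - ((ψ₀ n).val : ℤ) * ((1 : ℤ) + (5 : ℤ) * w + (0 : ℤ) * w ^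
            2))
          (by rw [map_sub, hψ₀k, hψ₀c, Int.cast_one, mul_one, sub_self])
          (by
            rw [map_sub, hψ₃k, hψ₃c, hv]
            generalize ψ₀ n = u
            revert u
            decide)
        exact ⟨r, k₂, ((ψ₀ n).val : ℤ), sub_eq_iff_eq_add.mp e⟩
      have e1 : (-7 - 7 * w) * (7 * (4 * w + w ^ 2)) =
          49 * φ (((-4 : ℤ) + (0 : ℤ) * csRoot 27) * (csRoot 27 - ((4 : ℤ) : AdjoinRoot (csPoly
              27))) + (-3 : ℤ) * ((5 : ℤ) : AdjoinRoot (csPoly 27))) := by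
        rw [hφb]
        push_cast
        linear_combination (-49) * rel
      have e2 : (-7 - 7 * w) * (7 * (7 + 12 * w + 3 * w ^ 2)) =
          49 * φ (((9 : ℤ) + (-1 : ℤ) * csRoot 27) * (csRoot 27 - ((4 : ℤ) : AdjoinRoot (csPoly
              27))) + (7 : ℤ) * ((5 : ℤ) : AdjoinRoot (csPoly 27))) := by
        rw [hφb]
        push_cast
        linear_combination (196 + 49 * w) * rel
      have e3 : (-7 - 7 * w) * (7 * ((1 : ℤ) + (5 : ℤ) * w + (0 : ℤ) * w ^ 2)) =
          49 * φ (((-47 : ℤ) + (2 : ℤ) * csRoot 27) * (csRoot 27 - ((4 : ℤ) : AdjoinRoot (csPoly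
              27))) + (-37 : ℤ) * ((5 : ℤ) : AdjoinRoot (csPoly 27))) := by
        rw [hφb]
        push_cast
        linear_combination (-686 - 98 * w) * rel
      have hn1 : (((9 : ℤ) + (-1 : ℤ) * w + (-1 : ℤ) * w ^ 2 : 𝓞 K)) ∈ N :=
        (hNV _).mpr ((hV _).mpr (by rw [hψ₀c, hψ₃c]; decide))
      have f1 : 49 * φ (csRoot 27 - ((4 : ℤ) : AdjoinRoot (csPoly 27))) = (-7 - 7 * w) * (7 * ((9
          : ℤ) + (-1 : ℤ) * w + (-1 : ℤ) * w ^ 2)) := by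
        rw [hφg]
        push_cast
        linear_combination (-49) * rel
      have hn2 : (((-12 : ℤ) + (0 : ℤ) * w + (1 : ℤ) * w ^ 2 : 𝓞 K)) ∈ N :=
        (hNV _).mpr ((hV _).mpr (by rw [hψ₀c, hψ₃c]; decide))
      have f2 : 49 * φ (((5 : ℤ) : AdjoinRoot (csPoly 27))) = (-7 - 7 * w) * (7 * ((-12 : ℤ) + (0
          : ℤ) * w + (1 : ℤ) * w ^ 2)) := by
        rw [map_intCast]
        push_cast
        linear_combination (49) * rel
      refine ⟨49 * ((-4 : ℤ) + (25 : ℤ) * csRoot 27 + (-1 : ℤ) * csRoot 27 ^ 2), a * 49,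
          mul_ne_zero h49A fun h => hX (by rw [← hx, h, map_zero]),
        mul_ne_zero ha0 h49A, Or.inr (Or.inr (Or.inr (Or.inl ?_)))⟩
      exact span_mul_eq_of_certificate φ hφinj hN hmapJ ha hx (map_ofNat φ 49) hdec
        (Ideal.mem_span_pair.mpr ⟨_, _, rfl⟩) (Ideal.mem_span_pair.mpr ⟨_, _, rfl⟩)
        (Ideal.mem_span_pair.mpr ⟨_, _, rfl⟩) e1 e2 e3 hn1 hn2 f1 f2
    · -- `V`-shape `line`, σ = 3: the class of `⟨Θ - 7, 17⟩`
      -- (`X = -7 + 7 * w`, `Y = 49`)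
      have hx : φ ((-10 : ℤ) + (-25 : ℤ) * csRoot 27 + (1 : ℤ) * csRoot 27 ^ 2) = (-7 + 7 * w) :=
          by
        rw [hφc]
        push_cast
        linear_combination (7 + w) * rel
      have hX : (-7 + 7 * w) ≠ 0 := by
        have hγ : (((-1 : ℤ) + (1 : ℤ) * w + (0 : ℤ) * w ^ 2 : 𝓞 K)) ≠ 0 := fun h => by
          have h' := congrArg ψ₀ h
          rw [hψ₀c, map_zero] at h'
          revert h'
          decide
        have e : (-7 + 7 * w) = 7 * (((-1 : ℤ) + (1 : ℤ) * w + (0 : ℤ) * w ^ 2 : 𝓞 K)) := by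
          push_cast
          ring
        rw [e]
        exact mul_ne_zero h7 hγ
      have hdec : ∀ n ∈ N, ∃ (r : AdjoinRoot (csPoly 27)) (k₂ k₃ : ℤ),
          n = φ r * (4 * w + w ^ 2) + k₂ * (7 + 12 * w + 3 * w ^ 2) + k₃ * ((1 : ℤ) + (3 : ℤ) * w
              + (0 : ℤ) * w ^ 2) := by
        intro n hn
        have hv := (hV _).mp ((hNV n).mp hn)
        dsimp only at hv
        obtain ⟨r, k₂, e⟩ := hdec0 (n - ((ψ₀ n).val : ℤ) * ((1 : ℤ) + (3 : ℤ) * w + (0 : ℤ) * w ^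
            2))
          (by rw [map_sub, hψ₀k, hψ₀c, Int.cast_one, mul_one, sub_self])
          (by
            rw [map_sub, hψ₃k, hψ₃c, hv]
            generalize ψ₀ n = u
            revert u
            decide)
        exact ⟨r, k₂, ((ψ₀ n).val : ℤ), sub_eq_iff_eq_add.mp e⟩
      have e1 : (-7 + 7 * w) * (7 * (4 * w + w ^ 2)) =
          49 * φ (((2 : ℤ) + (0 : ℤ) * csRoot 27) * (csRoot 27 - ((7 : ℤ) : AdjoinRoot (csPoly
              27))) + (1 : ℤ) * ((17 : ℤ) : AdjoinRoot (csPoly 27))) := by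
        rw [hφb]
        push_cast
        linear_combination (49) * rel
      have e2 : (-7 + 7 * w) * (7 * (7 + 12 * w + 3 * w ^ 2)) =
          49 * φ (((-12 : ℤ) + (1 : ℤ) * csRoot 27) * (csRoot 27 - ((7 : ℤ) : AdjoinRoot (csPoly
              27))) + (-5 : ℤ) * ((17 : ℤ) : AdjoinRoot (csPoly 27))) := by
        rw [hφb]
        push_cast
        linear_combination (-196 - 49 * w) * rel
      have e3 : (-7 + 7 * w) * (7 * ((1 : ℤ) + (3 : ℤ) * w + (0 : ℤ) * w ^ 2)) =
          49 * φ (((39 : ℤ) + (-2 : ℤ) * csRoot 27) * (csRoot 27 - ((7 : ℤ) : AdjoinRoot (csPoly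
              27))) + (16 : ℤ) * ((17 : ℤ) : AdjoinRoot (csPoly 27))) := by
        rw [hφb]
        push_cast
        linear_combination (686 + 98 * w) * rel
      have hn1 : (((5 : ℤ) + (1 : ℤ) * w + (0 : ℤ) * w ^ 2 : 𝓞 K)) ∈ N :=
        (hNV _).mpr ((hV _).mpr (by rw [hψ₀c, hψ₃c]; decide))
      have f1 : 49 * φ (csRoot 27 - ((7 : ℤ) : AdjoinRoot (csPoly 27))) = (-7 + 7 * w) * (7 * ((5
          : ℤ) + (1 : ℤ) * w + (0 : ℤ) * w ^ 2)) := by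
        rw [hφg]
        push_cast
        ring
      have hn2 : (((-10 : ℤ) + (2 : ℤ) * w + (1 : ℤ) * w ^ 2 : 𝓞 K)) ∈ N :=
        (hNV _).mpr ((hV _).mpr (by rw [hψ₀c, hψ₃c]; decide))
      have f2 : 49 * φ (((17 : ℤ) : AdjoinRoot (csPoly 27))) = (-7 + 7 * w) * (7 * ((-10 : ℤ) +
          (2 : ℤ) * w + (1 : ℤ) * w ^ 2)) := by
        rw [map_intCast]
        push_cast
        linear_combination (-49) * rel
      refine ⟨49 * ((-10 : ℤ) + (-25 : ℤ) * csRoot 27 + (1 : ℤ) * csRoot 27 ^ 2), a * 49,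
          mul_ne_zero h49A fun h => hX (by rw [← hx, h, map_zero]),
        mul_ne_zero ha0 h49A, Or.inr (Or.inr (Or.inl ?_))⟩
      exact span_mul_eq_of_certificate φ hφinj hN hmapJ ha hx (map_ofNat φ 49) hdec
        (Ideal.mem_span_pair.mpr ⟨_, _, rfl⟩) (Ideal.mem_span_pair.mpr ⟨_, _, rfl⟩)
        (Ideal.mem_span_pair.mpr ⟨_, _, rfl⟩) e1 e2 e3 hn1 hn2 f1 f2
    · -- `V`-shape `line`, σ = 4: the class of `⟨Θ - 10, 11⟩`
      -- (`X = -7 - 7 * w + 7 * w ^ 2`, `Y = 49`)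
      have hx : φ ((-6 : ℤ) + (132 : ℤ) * csRoot 27 + (-5 : ℤ) * csRoot 27 ^ 2) = (-7 - 7 * w + 7
          * w ^ 2) := by
        rw [hφc]
        push_cast
        linear_combination (-35 - 5 * w) * rel
      have hX : (-7 - 7 * w + 7 * w ^ 2) ≠ 0 := by
        have hγ : (((-1 : ℤ) + (-1 : ℤ) * w + (1 : ℤ) * w ^ 2 : 𝓞 K)) ≠ 0 := fun h => by
          have h' := congrArg ψ₀ h
          rw [hψ₀c, map_zero] at h'
          revert h'
          decide
        have e : (-7 - 7 * w + 7 * w ^ 2) = 7 * (((-1 : ℤ) + (-1 : ℤ) * w + (1 : ℤ) * w ^ 2 : 𝓞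
            K)) := by
          push_cast
          ring
        rw [e]
        exact mul_ne_zero h7 hγ
      have hdec : ∀ n ∈ N, ∃ (r : AdjoinRoot (csPoly 27)) (k₂ k₃ : ℤ),
          n = φ r * (4 * w + w ^ 2) + k₂ * (7 + 12 * w + 3 * w ^ 2) + k₃ * ((1 : ℤ) + (1 : ℤ) * w
              + (0 : ℤ) * w ^ 2) := by
        intro n hn
        have hv := (hV _).mp ((hNV n).mp hn)
        dsimp only at hv
        obtain ⟨r, k₂, e⟩ := hdec0 (n - ((ψ₀ n).val : ℤ) * ((1 : ℤ) + (1 : ℤ) * w + (0 : ℤ) * w ^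
            2))
          (by rw [map_sub, hψ₀k, hψ₀c, Int.cast_one, mul_one, sub_self])
          (by
            rw [map_sub, hψ₃k, hψ₃c, hv]
            generalize ψ₀ n = u
            revert u
            decide)
        exact ⟨r, k₂, ((ψ₀ n).val : ℤ), sub_eq_iff_eq_add.mp e⟩
      have e1 : (-7 - 7 * w + 7 * w ^ 2) * (7 * (4 * w + w ^ 2)) =
          49 * φ (((-10 : ℤ) + (1 : ℤ) * csRoot 27) * (csRoot 27 - ((10 : ℤ) : AdjoinRoot (csPoly
              27))) + (-9 : ℤ) * ((11 : ℤ) : AdjoinRoot (csPoly 27))) := by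
        rw [hφb]
        push_cast
        linear_combination (-245) * rel
      have e2 : (-7 - 7 * w + 7 * w ^ 2) * (7 * (7 + 12 * w + 3 * w ^ 2)) =
          49 * φ (((52 : ℤ) + (-2 : ℤ) * csRoot 27) * (csRoot 27 - ((10 : ℤ) : AdjoinRoot (csPoly
              27))) + (47 : ℤ) * ((11 : ℤ) : AdjoinRoot (csPoly 27))) := by
        rw [hφb]
        push_cast
        linear_combination (980 + 245 * w) * rel
      have e3 : (-7 - 7 * w + 7 * w ^ 2) * (7 * ((1 : ℤ) + (1 : ℤ) * w + (0 : ℤ) * w ^ 2)) =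
          49 * φ (((-31 : ℤ) + (2 : ℤ) * csRoot 27) * (csRoot 27 - ((10 : ℤ) : AdjoinRoot (csPoly
              27))) + (-28 : ℤ) * ((11 : ℤ) : AdjoinRoot (csPoly 27))) := by
        rw [hφb]
        push_cast
        linear_combination (-637 - 98 * w) * rel
      have hn1 : (((99 : ℤ) + (-3 : ℤ) * w + (-8 : ℤ) * w ^ 2 : 𝓞 K)) ∈ N :=
        (hNV _).mpr ((hV _).mpr (by rw [hψ₀c, hψ₃c]; decide))
      have f1 : 49 * φ (csRoot 27 - ((10 : ℤ) : AdjoinRoot (csPoly 27))) = (-7 - 7 * w + 7 * w ^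
          2) * (7 * ((99 : ℤ) + (-3 : ℤ) * w + (-8 : ℤ) * w ^ 2)) := by
        rw [hφg]
        push_cast
        linear_combination (-637 + 392 * w) * rel
      have hn2 : (((-109 : ℤ) + (4 : ℤ) * w + (9 : ℤ) * w ^ 2 : 𝓞 K)) ∈ N :=
        (hNV _).mpr ((hV _).mpr (by rw [hψ₀c, hψ₃c]; decide))
      have f2 : 49 * φ (((11 : ℤ) : AdjoinRoot (csPoly 27))) = (-7 - 7 * w + 7 * w ^ 2) * (7 *
          ((-109 : ℤ) + (4 : ℤ) * w + (9 : ℤ) * w ^ 2)) := by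
        rw [map_intCast]
        push_cast
        linear_combination (686 - 441 * w) * rel
      refine ⟨49 * ((-6 : ℤ) + (132 : ℤ) * csRoot 27 + (-5 : ℤ) * csRoot 27 ^ 2), a * 49,
          mul_ne_zero h49A fun h => hX (by rw [← hx, h, map_zero]),
        mul_ne_zero ha0 h49A, Or.inr (Or.inr (Or.inr (Or.inr (Or.inr (Or.inl ?_)))))⟩
      exact span_mul_eq_of_certificate φ hφinj hN hmapJ ha hx (map_ofNat φ 49) hdec
        (Ideal.mem_span_pair.mpr ⟨_, _, rfl⟩) (Ideal.mem_span_pair.mpr ⟨_, _, rfl⟩)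
        (Ideal.mem_span_pair.mpr ⟨_, _, rfl⟩) e1 e2 e3 hn1 hn2 f1 f2
    · -- `V`-shape `line`, σ = 5: the class of `⟨Θ - 14, 19⟩`
      -- (`X = -14 + 7 * w`, `Y = 49`)
      have hx : φ ((-17 : ℤ) + (-25 : ℤ) * csRoot 27 + (1 : ℤ) * csRoot 27 ^ 2) = (-14 + 7 * w)
          := by
        rw [hφc]
        push_cast
        linear_combination (7 + w) * rel
      have hX : (-14 + 7 * w) ≠ 0 := by
        have hγ : (((-2 : ℤ) + (1 : ℤ) * w + (0 : ℤ) * w ^ 2 : 𝓞 K)) ≠ 0 := fun h => by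
          have h' := congrArg ψ₀ h
          rw [hψ₀c, map_zero] at h'
          revert h'
          decide
        have e : (-14 + 7 * w) = 7 * (((-2 : ℤ) + (1 : ℤ) * w + (0 : ℤ) * w ^ 2 : 𝓞 K)) := by
          push_cast
          ring
        rw [e]
        exact mul_ne_zero h7 hγ
      have hdec : ∀ n ∈ N, ∃ (r : AdjoinRoot (csPoly 27)) (k₂ k₃ : ℤ),
          n = φ r * (4 * w + w ^ 2) + k₂ * (7 + 12 * w + 3 * w ^ 2) + k₃ * ((1 : ℤ) + (6 : ℤ) * w
              + (0 : ℤ) * w ^ 2) := by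
        intro n hn
        have hv := (hV _).mp ((hNV n).mp hn)
        dsimp only at hv
        obtain ⟨r, k₂, e⟩ := hdec0 (n - ((ψ₀ n).val : ℤ) * ((1 : ℤ) + (6 : ℤ) * w + (0 : ℤ) * w ^
            2))
          (by rw [map_sub, hψ₀k, hψ₀c, Int.cast_one, mul_one, sub_self])
          (by
            rw [map_sub, hψ₃k, hψ₃c, hv]
            generalize ψ₀ n = u
            revert u
            decide)
        exact ⟨r, k₂, ((ψ₀ n).val : ℤ), sub_eq_iff_eq_add.mp e⟩
      have e1 : (-14 + 7 * w) * (7 * (4 * w + w ^ 2)) =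
          49 * φ (((1 : ℤ) + (0 : ℤ) * csRoot 27) * (csRoot 27 - ((14 : ℤ) : AdjoinRoot (csPoly
              27))) + (1 : ℤ) * ((19 : ℤ) : AdjoinRoot (csPoly 27))) := by
        rw [hφb]
        push_cast
        linear_combination (49) * rel
      have e2 : (-14 + 7 * w) * (7 * (7 + 12 * w + 3 * w ^ 2)) =
          49 * φ (((-8 : ℤ) + (1 : ℤ) * csRoot 27) * (csRoot 27 - ((14 : ℤ) : AdjoinRoot (csPoly
              27))) + (-6 : ℤ) * ((19 : ℤ) : AdjoinRoot (csPoly 27))) := by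
        rw [hφb]
        push_cast
        linear_combination (-196 - 49 * w) * rel
      have e3 : (-14 + 7 * w) * (7 * ((1 : ℤ) + (6 : ℤ) * w + (0 : ℤ) * w ^ 2)) =
          49 * φ (((61 : ℤ) + (-5 : ℤ) * csRoot 27) * (csRoot 27 - ((14 : ℤ) : AdjoinRoot (csPoly
              27))) + (45 : ℤ) * ((19 : ℤ) : AdjoinRoot (csPoly 27))) := by
        rw [hφb]
        push_cast
        linear_combination (1715 + 245 * w) * rel
      have hn1 : (((6 : ℤ) + (1 : ℤ) * w + (0 : ℤ) * w ^ 2 : 𝓞 K)) ∈ N :=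
        (hNV _).mpr ((hV _).mpr (by rw [hψ₀c, hψ₃c]; decide))
      have f1 : 49 * φ (csRoot 27 - ((14 : ℤ) : AdjoinRoot (csPoly 27))) = (-14 + 7 * w) * (7 *
          ((6 : ℤ) + (1 : ℤ) * w + (0 : ℤ) * w ^ 2)) := by
        rw [hφg]
        push_cast
        ring
      have hn2 : (((-6 : ℤ) + (3 : ℤ) * w + (1 : ℤ) * w ^ 2 : 𝓞 K)) ∈ N :=
        (hNV _).mpr ((hV _).mpr (by rw [hψ₀c, hψ₃c]; decide))
      have f2 : 49 * φ (((19 : ℤ) : AdjoinRoot (csPoly 27))) = (-14 + 7 * w) * (7 * ((-6 : ℤ) +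
          (3 : ℤ) * w + (1 : ℤ) * w ^ 2)) := by
        rw [map_intCast]
        push_cast
        linear_combination (-49) * rel
      refine ⟨49 * ((-17 : ℤ) + (-25 : ℤ) * csRoot 27 + (1 : ℤ) * csRoot 27 ^ 2), a * 49,
          mul_ne_zero h49A fun h => hX (by rw [← hx, h, map_zero]),
        mul_ne_zero ha0 h49A, Or.inr (Or.inr (Or.inr (Or.inr (Or.inr (Or.inr (?_))))))⟩
      exact span_mul_eq_of_certificate φ hφinj hN hmapJ ha hx (map_ofNat φ 49) hdec
        (Ideal.mem_span_pair.mpr ⟨_, _, rfl⟩) (Ideal.mem_span_pair.mpr ⟨_, _, rfl⟩)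
        (Ideal.mem_span_pair.mpr ⟨_, _, rfl⟩) e1 e2 e3 hn1 hn2 f1 f2
    · -- `V`-shape `line`, σ = 6: the class of `⟨Θ - 11, 13⟩`
      -- (`X = -14 - 7 * w`, `Y = 49`)
      have hx : φ ((-11 : ℤ) + (25 : ℤ) * csRoot 27 + (-1 : ℤ) * csRoot 27 ^ 2) = (-14 - 7 * w)
          := by
        rw [hφc]
        push_cast
        linear_combination (-7 - w) * rel
      have hX : (-14 - 7 * w) ≠ 0 := by
        have hγ : (((-2 : ℤ) + (-1 : ℤ) * w + (0 : ℤ) * w ^ 2 : 𝓞 K)) ≠ 0 := fun h => by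
          have h' := congrArg ψ₀ h
          rw [hψ₀c, map_zero] at h'
          revert h'
          decide
        have e : (-14 - 7 * w) = 7 * (((-2 : ℤ) + (-1 : ℤ) * w + (0 : ℤ) * w ^ 2 : 𝓞 K)) := by
          push_cast
          ring
        rw [e]
        exact mul_ne_zero h7 hγ
      have hdec : ∀ n ∈ N, ∃ (r : AdjoinRoot (csPoly 27)) (k₂ k₃ : ℤ),
          n = φ r * (4 * w + w ^ 2) + k₂ * (7 + 12 * w + 3 * w ^ 2) + k₃ * ((1 : ℤ) + (4 : ℤ) * w
              + (0 : ℤ) * w ^ 2) := by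
        intro n hn
        have hv := (hV _).mp ((hNV n).mp hn)
        dsimp only at hv
        obtain ⟨r, k₂, e⟩ := hdec0 (n - ((ψ₀ n).val : ℤ) * ((1 : ℤ) + (4 : ℤ) * w + (0 : ℤ) * w ^
            2))
          (by rw [map_sub, hψ₀k, hψ₀c, Int.cast_one, mul_one, sub_self])
          (by
            rw [map_sub, hψ₃k, hψ₃c, hv]
            generalize ψ₀ n = u
            revert u
            decide)
        exact ⟨r, k₂, ((ψ₀ n).val : ℤ), sub_eq_iff_eq_add.mp e⟩
      have e1 : (-14 - 7 * w) * (7 * (4 * w + w ^ 2)) =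
          49 * φ (((-5 : ℤ) + (0 : ℤ) * csRoot 27) * (csRoot 27 - ((11 : ℤ) : AdjoinRoot (csPoly
              27))) + (-4 : ℤ) * ((13 : ℤ) : AdjoinRoot (csPoly 27))) := by
        rw [hφb]
        push_cast
        linear_combination (-49) * rel
      have e2 : (-14 - 7 * w) * (7 * (7 + 12 * w + 3 * w ^ 2)) =
          49 * φ (((-1 : ℤ) + (-1 : ℤ) * csRoot 27) * (csRoot 27 - ((11 : ℤ) : AdjoinRoot (csPoly
              27))) + (-1 : ℤ) * ((13 : ℤ) : AdjoinRoot (csPoly 27))) := by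
        rw [hφb]
        push_cast
        linear_combination (196 + 49 * w) * rel
      have e3 : (-14 - 7 * w) * (7 * ((1 : ℤ) + (4 : ℤ) * w + (0 : ℤ) * w ^ 2)) =
          49 * φ (((-18 : ℤ) + (1 : ℤ) * csRoot 27) * (csRoot 27 - ((11 : ℤ) : AdjoinRoot (csPoly
              27))) + (-15 : ℤ) * ((13 : ℤ) : AdjoinRoot (csPoly 27))) := by
        rw [hφb]
        push_cast
        linear_combination (-343 - 49 * w) * rel
      have hn1 : (((8 : ℤ) + (0 : ℤ) * w + (-1 : ℤ) * w ^ 2 : 𝓞 K)) ∈ N :=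
        (hNV _).mpr ((hV _).mpr (by rw [hψ₀c, hψ₃c]; decide))
      have f1 : 49 * φ (csRoot 27 - ((11 : ℤ) : AdjoinRoot (csPoly 27))) = (-14 - 7 * w) * (7 *
          ((8 : ℤ) + (0 : ℤ) * w + (-1 : ℤ) * w ^ 2)) := by
        rw [hφg]
        push_cast
        linear_combination (-49) * rel
      have hn2 : (((-10 : ℤ) + (-1 : ℤ) * w + (1 : ℤ) * w ^ 2 : 𝓞 K)) ∈ N :=
        (hNV _).mpr ((hV _).mpr (by rw [hψ₀c, hψ₃c]; decide))
      have f2 : 49 * φ (((13 : ℤ) : AdjoinRoot (csPoly 27))) = (-14 - 7 * w) * (7 * ((-10 : ℤ) +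
          (-1 : ℤ) * w + (1 : ℤ) * w ^ 2)) := by
        rw [map_intCast]
        push_cast
        linear_combination (49) * rel
      refine ⟨49 * ((-11 : ℤ) + (25 : ℤ) * csRoot 27 + (-1 : ℤ) * csRoot 27 ^ 2), a * 49,
          mul_ne_zero h49A fun h => hX (by rw [← hx, h, map_zero]),
        mul_ne_zero ha0 h49A, Or.inr (Or.inr (Or.inr (Or.inr (Or.inl ?_))))⟩
      exact span_mul_eq_of_certificate φ hφinj hN hmapJ ha hx (map_ofNat φ 49) hdec
        (Ideal.mem_span_pair.mpr ⟨_, _, rfl⟩) (Ideal.mem_span_pair.mpr ⟨_, _, rfl⟩)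
        (Ideal.mem_span_pair.mpr ⟨_, _, rfl⟩) e1 e2 e3 hn1 hn2 f1 f2
  · -- `V`-shape `inf`: the class of `⟨Θ - 2, 7⟩`
    -- (`X = 28 + 7 * w`, `Y = 49`)
    have hx : φ ((25 : ℤ) + (-25 : ℤ) * csRoot 27 + (1 : ℤ) * csRoot 27 ^ 2) = (28 + 7 * w) :=
        by
      rw [hφc]
      push_cast
      linear_combination (7 + w) * rel
    have hX : (28 + 7 * w) ≠ 0 := by
      have hγ : (((4 : ℤ) + (1 : ℤ) * w + (0 : ℤ) * w ^ 2 : 𝓞 K)) ≠ 0 := fun h => by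
        have h' := congrArg ψ₀ h
        rw [hψ₀c, map_zero] at h'
        revert h'
        decide
      have e : (28 + 7 * w) = 7 * (((4 : ℤ) + (1 : ℤ) * w + (0 : ℤ) * w ^ 2 : 𝓞 K)) := by
        push_cast
        ring
      rw [e]
      exact mul_ne_zero h7 hγ
    have hdec : ∀ n ∈ N, ∃ (r : AdjoinRoot (csPoly 27)) (k₂ k₃ : ℤ),
        n = φ r * (4 * w + w ^ 2) + k₂ * (7 + 12 * w + 3 * w ^ 2) + k₃ * ((0 : ℤ) + (1 : ℤ) * w
            + (0 : ℤ) * w ^ 2) := by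
      intro n hn
      have hv := (hV _).mp ((hNV n).mp hn)
      dsimp only at hv
      obtain ⟨r, k₂, e⟩ := hdec0 (n - ((5 * ψ₃ n).val : ℤ) * ((0 : ℤ) + (1 : ℤ) * w + (0 : ℤ) *
          w ^ 2))
        (by rw [map_sub, hψ₀k, hψ₀c, hv, Int.cast_zero, mul_zero, sub_self])
        (by
          rw [map_sub, hψ₃k, hψ₃c]
          generalize ψ₃ n = u
          revert u
          decide)
      exact ⟨r, k₂, ((5 * ψ₃ n).val : ℤ), sub_eq_iff_eq_add.mp e⟩
    have e1 : (28 + 7 * w) * (7 * (4 * w + w ^ 2)) =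
        49 * φ (((7 : ℤ) + (0 : ℤ) * csRoot 27) * (csRoot 27 - ((2 : ℤ) : AdjoinRoot (csPoly
            27))) + (1 : ℤ) * ((7 : ℤ) : AdjoinRoot (csPoly 27))) := by
      rw [hφb]
      push_cast
      linear_combination (49) * rel
    have e2 : (28 + 7 * w) * (7 * (7 + 12 * w + 3 * w ^ 2)) =
        49 * φ (((-2 : ℤ) + (1 : ℤ) * csRoot 27) * (csRoot 27 - ((2 : ℤ) : AdjoinRoot (csPoly
            27))) + (0 : ℤ) * ((7 : ℤ) : AdjoinRoot (csPoly 27))) := by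
      rw [hφb]
      push_cast
      linear_combination (-196 - 49 * w) * rel
    have e3 : (28 + 7 * w) * (7 * ((0 : ℤ) + (1 : ℤ) * w + (0 : ℤ) * w ^ 2)) =
        49 * φ (((1 : ℤ) + (0 : ℤ) * csRoot 27) * (csRoot 27 - ((2 : ℤ) : AdjoinRoot (csPoly
            27))) + (0 : ℤ) * ((7 : ℤ) : AdjoinRoot (csPoly 27))) := by
      rw [hφb]
      push_cast
      ring
    have hn1 : (((0 : ℤ) + (1 : ℤ) * w + (0 : ℤ) * w ^ 2 : 𝓞 K)) ∈ N :=
      (hNV _).mpr ((hV _).mpr (by rw [hψ₀c, hψ₃c]; decide))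
    have f1 : 49 * φ (csRoot 27 - ((2 : ℤ) : AdjoinRoot (csPoly 27))) = (28 + 7 * w) * (7 * ((0
        : ℤ) + (1 : ℤ) * w + (0 : ℤ) * w ^ 2)) := by
      rw [hφg]
      push_cast
      ring
    have hn2 : (((0 : ℤ) + (-3 : ℤ) * w + (1 : ℤ) * w ^ 2 : 𝓞 K)) ∈ N :=
      (hNV _).mpr ((hV _).mpr (by rw [hψ₀c, hψ₃c]; decide))
    have f2 : 49 * φ (((7 : ℤ) : AdjoinRoot (csPoly 27))) = (28 + 7 * w) * (7 * ((0 : ℤ) + (-3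
        : ℤ) * w + (1 : ℤ) * w ^ 2)) := by
      rw [map_intCast]
      push_cast
      linear_combination (-49) * rel
    refine ⟨49 * ((25 : ℤ) + (-25 : ℤ) * csRoot 27 + (1 : ℤ) * csRoot 27 ^ 2), a * 49,
        mul_ne_zero h49A fun h => hX (by rw [← hx, h, map_zero]),
      mul_ne_zero ha0 h49A, Or.inr (Or.inl ?_)⟩
    exact span_mul_eq_of_certificate φ hφinj hN hmapJ ha hx (map_ofNat φ 49) hdec
      (Ideal.mem_span_pair.mpr ⟨_, _, rfl⟩) (Ideal.mem_span_pair.mpr ⟨_, _, rfl⟩)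
      (Ideal.mem_span_pair.mpr ⟨_, _, rfl⟩) e1 e2 e3 hn1 hn2 f1 f2

end Field

/-! ### The model `ℤ[Θ₂₇] = ℤ[x]/(f₂₇)` with `K = ℚ[x]/(f₂₇)` -/

/-- **Kim–Yamada, Theorem 4.17 (covering form)** for the order `ℤ[Θ₂₇] = AdjoinRoot (csPoly 27)`:
every non-zero ideal `J` satisfies `x J = y ⟨Θ₂₇ - c, d⟩` with `x, y ≠ 0` and
`(c, d) ∈ {(1,1), (2,7), (7,17), (4,5), (11,13), (10,11), (14,19)}` — the hypothesis `hcover` of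
`exists_isConj_standardCSMatrix_of_cover` / `gompfConjectureForTrace_of_cover` at `n = 27`.
[cite: KimYamada2023, §4.3 Thm. 4.17] -/
theorem ideal_class_adjoinRoot_twentyseven (J : Ideal (AdjoinRoot (csPoly 27))) (hJ : J ≠ ⊥) :
    ∃ x y : AdjoinRoot (csPoly 27), x ≠ 0 ∧ y ≠ 0 ∧
      (span {x} * J = span {y} * csIdeal 1 1 27 ∨ span {x} * J = span {y} * csIdeal 2 7 27 ∨
        span {x} * J = span {y} * csIdeal 7 17 27 ∨ span {x} * J = span {y} * csIdeal 4 5 27 ∨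
        span {x} * J = span {y} * csIdeal 11 13 27 ∨ span {x} * J = span {y} * csIdeal 10 11 27 ∨
        span {x} * J = span {y} * csIdeal 14 19 27) :=
  ideal_class_adjoinRoot_twentyseven_of_root (aeval_root_csPoly 27) (finrank_CSField 27) J hJ

end Literature.Topology.FourManifolds
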